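import Summits.ValiantsHypothesis.ValiantsHypothesis.Theorems.LacunarySymmetroidMatrixDescartesCensusDoorA34SheetIsotropicCone
import Summits.ValiantsHypothesis.ValiantsHypothesis.Theorems.LacunarySymmetroidMatrixDescartesCensusDoorA34SheetDefiniteLetterCells

/-!
# `MatrixDescartes` census — DOOR A at `(3,4)`: the SEMIDEFINITE PAIR TEST on the null-top sheet — half of the semidefinite cell of `stub_nullTopCeiling`
# closed on every chamber whose Descartes word violates the pair law (all sorted supports; instances on the census bulk supports)

HONEST FRAMING.  Object-search cell `pub-symmetroid`, engine seat `val-sym-eng-2` (g5); helper rows beside the registered strata line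
`Cruxes/DoorA34/Lines/strata.lean` on stmt-ValiantsHypothesis-19980 (`DoorA34 = PosRootLawAt 3 4 18`: OPEN, typed, never asserted here).  By
…NullTopEighteenAnatomy / …SheetRankParity a counterexample to `stub_nullTopCeiling` on a sorted support is Descartes-sharp on the `19` sheet slots, every slot
coefficient sign being `(−1)^{ρ(e)}·sign det S₀` (`ρ` = sheet rank, computable from `d`).  The PAIR LAW of …SheetIsotropicCone (valid with NO definite letter)
then reads, for two lower letters `x ≠ y`:

* `semidef_pair_relation_of_nullTop_eighteen` (`S₃ ⪰ 0`): `c_{3xx}, c_{3yy} > 0 ⇒ c_{33x}·c_{33y}·c_{3xy} > 0`; `…_neg` (`S₃ ⪯ 0`): `c_{3xx}, c_{3yy} < 0 ⇒ … < 0`;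
* **`card_posRoots_le_17_of_semidef_pairTest`** (all sorted supports, decidable in `d`): if `ρ(2d_x+d₃) ≡ ρ(2d_y+d₃)` and
  `ρ(d_x+d_y+d₃) + ρ(2d₃+d_x) + ρ(2d₃+d_y) ≢ ρ(2d_x+d₃) (mod 2)`, then `S₃ ⪰ 0 ∧ (−1)^{ρ(2d_x+d₃)} det S₀ > 0` or `S₃ ⪯ 0 ∧ (−1)^{ρ(2d_x+d₃)} det S₀ < 0`
  forces `Z₊ ≤ 17` — ONE ORIENTATION of the semidefinite cell is closed on every such chamber (this seat's atlas: `11 + 23 = 34` of the `2 × 80` oriented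
  semidefinite chamber classes of the null-top sheet; the `80` exponent chambers are the faces of the arrangement `{σ(s) = σ(s')}` — seat report);
* instances (`decide`): the census BULK supports `(0,4,9,16)`, `(0,8,17,29)`, `(0,10,22,38)` (chamber of `(0,3,7,12)`) and `(0,8,14,23)` — a null-top eighteen
  there with `S₃ ⪰ 0` has `det S₀ < 0`, with `S₃ ⪯ 0` has `det S₀ > 0` — and the small interleaved supports `(0,3,10,11)`, `(0,1,8,11)` (opposite orientation).

LOCATED COMPLEMENT (seat report HOME/DOOR-A34-ENG2G5-REPORT.md, not a kernel claim): in the INDEFINITE cell the fully alternating sheet word is realised by exact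
rational symmetric letters on `78+` of the `80` chambers, and in the semidefinite cell on every oriented class NOT killed by this test that the seat's search
reached — i.e. rank parity + the pair law appear to be the COMPLETE list of sign-level laws of the null-top sheet; everything else needs magnitude rows
(`sheet_newton_row`) or root-level arguments.  Nothing here bounds anything else; `DoorA34` and the three stubs stay OPEN; registers unchanged; nothing on
`MatrixDescartes` (stmt-ValiantsHypothesis-18050) or `VP ≠ VNP` — VP≠VNP not moved.  [folklore] Descartes' rule (sharp case) bookkeeping; elementary.
-/

-- `Summit.ValiantsHypothesis.ValiantsHypothesis.…` repeats a component by the D-0017 layout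
-- (single-conjunct summit), which the `dupNamespace` linter flags; the name is mandated.
set_option linter.dupNamespace false

namespace Summit.ValiantsHypothesis.ValiantsHypothesis.Theorems.LacunarySymmetroidMatrixDescartes.Census

open Polynomial Finset Matrix
open scoped BigOperators Polynomial Matrix

/-! ## 4. On a hypothetical null-top EIGHTEEN: the pair relations, and the chamber test closing half of the semidefinite cell -/

/-- The MIXED slot `{i,j,k}`: coefficient `tr((adj(S_i+S_j) − adj S_i − adj S_j)·S_k)` and membership, on the sheet of a null-top eighteen (sorted support,
`i, j, k` pairwise distinct). [folklore] -/
theorem coeff_mixed_of_nullTop_eighteen (d : Fin 4 → ℕ) (hd : StrictMono d) (S : Fin 4 → Matrix (Fin 3) (Fin 3) ℝ) (h3 : (S 3).det = 0)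
    (h18 : 18 ≤ ((Matrix.det (∑ l, ((X : ℝ[X]) ^ d l) • (S l).map C)).roots.toFinset.filter (fun t => 0 < t)).card)
    (i j k : Fin 4) (hij : i ≠ j) (hik : i ≠ k) (hjk : j ≠ k) :
    (Matrix.det (∑ l, ((X : ℝ[X]) ^ d l) • (S l).map C)).coeff (d i + d j + d k)
        = (((S i + S j).adjugate - (S i).adjugate - (S j).adjugate) * S k).trace ∧
    d i + d j + d k ∈ (Matrix.det (∑ l, ((X : ℝ[X]) ^ d l) • (S l).map C)).support := by
  have hcard : Multiset.card ({i, j, k} : Multiset (Fin 4)) = 3 := by simp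
  have hs : (⟨{i, j, k}, hcard⟩ : Sym (Fin 4) 3) ≠ Sym.replicate 3 3 := by
    refine sym_mk_ne_replicate hcard 3 fun e => ?_
    have hi : i ∈ Multiset.replicate 3 (3 : Fin 4) := by rw [← e]; simp
    have hj : j ∈ Multiset.replicate 3 (3 : Fin 4) := by rw [← e]; simp
    exact hij ((Multiset.eq_of_mem_replicate hi).trans (Multiset.eq_of_mem_replicate hj).symm)
  have hσ : ((((⟨{i, j, k}, hcard⟩ : Sym (Fin 4) 3)) : Multiset (Fin 4)).map d).sum = d i + d j + d k := by
    simp only [Multiset.insert_eq_cons, Multiset.map_cons, Multiset.sum_cons, Multiset.map_singleton, Multiset.sum_singleton]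
    ring
  have huniq : ∀ f : Fin 3 → Fin 4, (∑ t, d (f t)) = d i + d j + d k →
      f = ![i, j, k] ∨ f = ![i, k, j] ∨ f = ![j, i, k] ∨ f = ![j, k, i] ∨ f = ![k, i, j] ∨ f = ![k, j, i] := by
    intro f hf
    have h := sym_eq_of_sum_eq_of_nullTop_eighteen d hd S h3 h18 _ hs f (hf.trans hσ.symm)
    have hval : (Finset.univ.val.map f : Multiset (Fin 4)) = {i, j, k} := by
      have := congrArg (fun u : Sym (Fin 4) 3 => (u : Multiset (Fin 4))) h
      simpa using this
    exact fun_eq_of_map_univ_eq_triple i j k hij hik hjk f hval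
  refine ⟨coeff_det_pencil_three_mixed d S hij hik hjk huniq, ?_⟩
  rw [support_det_pencil_eq_of_nullTop_eighteen d S h3 h18]
  exact Finset.mem_image.mpr ⟨_, Finset.mem_erase.mpr ⟨hs, Finset.mem_univ _⟩, hσ⟩

/-- **Pair sign from rank parity.**  On a null-top eighteen, two support exponents `e, e'` with ranks of EQUAL parity carry coefficients of the same sign,
with ranks of DIFFERENT parity coefficients of opposite signs. [folklore] -/
theorem coeff_mul_coeff_sign_of_nullTop_eighteen (d : Fin 4 → ℕ) (S : Fin 4 → Matrix (Fin 3) (Fin 3) ℝ) (h3 : (S 3).det = 0)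
    (h18 : 18 ≤ ((Matrix.det (∑ l, ((X : ℝ[X]) ^ d l) • (S l).map C)).roots.toFinset.filter (fun t => 0 < t)).card)
    {e e' : ℕ} (he : e ∈ (Matrix.det (∑ l, ((X : ℝ[X]) ^ d l) • (S l).map C)).support)
    (he' : e' ∈ (Matrix.det (∑ l, ((X : ℝ[X]) ^ d l) • (S l).map C)).support) :
    ((((Matrix.det (∑ l, ((X : ℝ[X]) ^ d l) • (S l).map C)).support.filter (· < e)).card
        + ((Matrix.det (∑ l, ((X : ℝ[X]) ^ d l) • (S l).map C)).support.filter (· < e')).card) % 2 = 0 →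
      0 < (Matrix.det (∑ l, ((X : ℝ[X]) ^ d l) • (S l).map C)).coeff e * (Matrix.det (∑ l, ((X : ℝ[X]) ^ d l) • (S l).map C)).coeff e') ∧
    ((((Matrix.det (∑ l, ((X : ℝ[X]) ^ d l) • (S l).map C)).support.filter (· < e)).card
        + ((Matrix.det (∑ l, ((X : ℝ[X]) ^ d l) • (S l).map C)).support.filter (· < e')).card) % 2 = 1 →
      (Matrix.det (∑ l, ((X : ℝ[X]) ^ d l) • (S l).map C)).coeff e * (Matrix.det (∑ l, ((X : ℝ[X]) ^ d l) • (S l).map C)).coeff e' < 0) := by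
  have key := pow_rank_mul_coeff_mul_coeff_pos_of_sharp _ (sharp_of_nullTop_eighteen d S h3 h18) he he'
  rcases mod_two_of_neg_one_pow_mul_pos key with ⟨p, w⟩ | ⟨p, w⟩
  · exact ⟨fun _ => w, fun h => by omega⟩
  · exact ⟨fun h => by omega, fun _ => w⟩

/-- **PAIR RELATION on a null-top eighteen, `S₃ ⪰ 0`.**  Sorted support, symmetric letters, `det S₃ = 0`, `S₃ ⪰ 0`, `18` roots, lower letters `x ≠ y`:
`c_{3xx} > 0 ∧ c_{3yy} > 0 ⇒ 0 < c_{33x}·c_{33y}·c_{3xy}` (slot coefficients in trace currency). [folklore] -/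
theorem semidef_pair_relation_of_nullTop_eighteen (d : Fin 4 → ℕ) (hd : StrictMono d) (S : Fin 4 → Matrix (Fin 3) (Fin 3) ℝ)
    (hS : ∀ l, (S l).IsSymm) (h3 : (S 3).det = 0) (hpsd : (S 3).PosSemidef)
    (h18 : 18 ≤ ((Matrix.det (∑ l, ((X : ℝ[X]) ^ d l) • (S l).map C)).roots.toFinset.filter (fun t => 0 < t)).card)
    {x y : Fin 4} (hx : x ≠ 3) (hqx : 0 < ((S x).adjugate * S 3).trace) (hqy : 0 < ((S y).adjugate * S 3).trace) :
    0 < ((S 3).adjugate * S x).trace * ((S 3).adjugate * S y).trace * (((S x + S y).adjugate - (S x).adjugate - (S y).adjugate) * S 3).trace :=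
  sheet_pair_law_slots hpsd h3 (hS x) (hS y) hqx hqy (trace_adjugate_mul_ne_zero_of_nullTop_eighteen d hd S h3 h18 3 x hx.symm)

/-- **PAIR RELATION on a null-top eighteen, `S₃ ⪯ 0`.**  The mirror cell: `c_{3xx} < 0 ∧ c_{3yy} < 0 ⇒ c_{33x}·c_{33y}·c_{3xy} < 0`. [folklore] -/
theorem semidef_pair_relation_of_nullTop_eighteen_neg (d : Fin 4 → ℕ) (hd : StrictMono d) (S : Fin 4 → Matrix (Fin 3) (Fin 3) ℝ)
    (hS : ∀ l, (S l).IsSymm) (h3 : (S 3).det = 0) (hnsd : (-(S 3)).PosSemidef)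
    (h18 : 18 ≤ ((Matrix.det (∑ l, ((X : ℝ[X]) ^ d l) • (S l).map C)).roots.toFinset.filter (fun t => 0 < t)).card)
    {x y : Fin 4} (hx : x ≠ 3) (hqx : ((S x).adjugate * S 3).trace < 0) (hqy : ((S y).adjugate * S 3).trace < 0) :
    ((S 3).adjugate * S x).trace * ((S 3).adjugate * S y).trace * (((S x + S y).adjugate - (S x).adjugate - (S y).adjugate) * S 3).trace < 0 :=
  sheet_pair_law_slots_neg hnsd h3 (hS x) (hS y) hqx hqy (trace_adjugate_mul_ne_zero_of_nullTop_eighteen d hd S h3 h18 3 x hx.symm)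

/-- **THE SEMIDEFINITE PAIR TEST (all sorted supports, decidable in `d`).**  Let `ρ` be the SHEET RANK (`ρ(e) = #{sheet exponents < e}`, computable from
`d`).  Suppose two lower letters `x ≠ y` have square middle slots of EQUAL rank parity (`ρ(2d_x+d₃) ≡ ρ(2d_y+d₃)`) while the mixed slot and the two top slots
have total parity DIFFERENT from it (`ρ(d_x+d_y+d₃) + ρ(2d₃+d_x) + ρ(2d₃+d_y) ≢ ρ(2d_x+d₃)`): then the Descartes-sharp word of an eighteen would give
`c_{3xx}, c_{3yy}` a common sign `s` and `c_{33x}c_{33y}c_{3xy}` the sign `−s` — against the pair law when `s·S₃ ⪰ 0`.  So, with the ORIENTATION read off the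
bottom cube (`sign c_e = (−1)^{ρ(e)}·sign det S₀`): `S₃ ⪰ 0 ∧ (−1)^{ρ(2d_x+d₃)}·det S₀ > 0`, or `S₃ ⪯ 0 ∧ (−1)^{ρ(2d_x+d₃)}·det S₀ < 0`, forces `Z₊ ≤ 17`.
HALF of the semidefinite cell of `stub_nullTopCeiling` on every chamber passing the test (34 of the 160 oriented chamber classes, this seat's atlas). [folklore] -/
theorem card_posRoots_le_17_of_semidef_pairTest (d : Fin 4 → ℕ) (hd : StrictMono d) (S : Fin 4 → Matrix (Fin 3) (Fin 3) ℝ)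
    (hS : ∀ l, (S l).IsSymm) (h3 : (S 3).det = 0)
    (ρ : ℕ → ℕ) (hρ : ∀ e, ρ e = ((((Finset.univ : Finset (Sym (Fin 4) 3)).erase (Sym.replicate 3 3)).image
          (fun s : Sym (Fin 4) 3 => ((s : Multiset (Fin 4)).map d).sum)).filter (· < e)).card)
    {x y : Fin 4} (hxy : x ≠ y) (hx : x ≠ 3) (hy : y ≠ 3)
    (hsq : ρ (2 * d x + d 3) % 2 = ρ (2 * d y + d 3) % 2)
    (hmix : (ρ (d x + d y + d 3) + ρ (2 * d 3 + d x) + ρ (2 * d 3 + d y)) % 2 ≠ ρ (2 * d x + d 3) % 2)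
    (hor : ((S 3).PosSemidef ∧ 0 < (-1 : ℝ) ^ ρ (2 * d x + d 3) * (S 0).det)
      ∨ ((-(S 3)).PosSemidef ∧ (-1 : ℝ) ^ ρ (2 * d x + d 3) * (S 0).det < 0)) :
    ((Matrix.det (∑ l, ((X : ℝ[X]) ^ d l) • (S l).map C)).roots.toFinset.filter (fun t => 0 < t)).card ≤ 17 := by
  by_contra hlt
  have h18 : 18 ≤ ((Matrix.det (∑ l, ((X : ℝ[X]) ^ d l) • (S l).map C)).roots.toFinset.filter (fun t => 0 < t)).card := by omega
  set P := Matrix.det (∑ l, ((X : ℝ[X]) ^ d l) • (S l).map C) with hP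
  -- the sheet rank IS the support rank on an eighteen
  have hρ' : ∀ e, ρ e = (P.support.filter (· < e)).card := fun e => by
    rw [hρ, hP, sheetRank_eq_of_nullTop_eighteen d S h3 h18]
  -- dictionary + membership of the six slots involved
  obtain ⟨cxx, mxx⟩ := coeff_square_of_nullTop_eighteen d hd S h3 h18 x 3 hx
  obtain ⟨cyy, myy⟩ := coeff_square_of_nullTop_eighteen d hd S h3 h18 y 3 hy
  obtain ⟨cTx, mTx⟩ := coeff_square_of_nullTop_eighteen d hd S h3 h18 3 x hx.symm
  obtain ⟨cTy, mTy⟩ := coeff_square_of_nullTop_eighteen d hd S h3 h18 3 y hy.symm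
  obtain ⟨cxy, mxy⟩ := coeff_mixed_of_nullTop_eighteen d hd S h3 h18 x y 3 hxy hx hy
  obtain ⟨c0, m0⟩ := coeff_cube_of_nullTop_eighteen d hd S h3 h18 0 (by decide)
  -- rank of the bottom cube is `0`
  have hrank0 : (P.support.filter (fun c => c < 3 * d 0)).card = 0 := by
    rw [Finset.card_eq_zero, Finset.filter_eq_empty_iff]
    intro c hc
    rw [hP, support_det_pencil_eq_of_nullTop_eighteen d S h3 h18] at hc
    obtain ⟨s, -, rfl⟩ := Finset.mem_image.mp hc
    exact not_lt.mpr (bottom_le_sym_sum_of_strictMono d hd s)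
  -- (i) `c_{3xx}·c_{3yy} > 0`
  have r1 := (coeff_mul_coeff_sign_of_nullTop_eighteen d S h3 h18 mxx myy).1 (by rw [← hρ', ← hρ']; omega)
  rw [cxx, cyy] at r1
  -- (ii) `c_{3xx}·(c_{3xy}·c_{33x}·c_{33y}) < 0`
  have r2 := coeff_mul_coeff_sign_of_nullTop_eighteen d S h3 h18 mxx mxy
  have r3 := coeff_mul_coeff_sign_of_nullTop_eighteen d S h3 h18 mTx mTy
  rw [cxx, cxy, ← hρ', ← hρ'] at r2
  rw [cTx, cTy, ← hρ', ← hρ'] at r3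
  have neg : ((S x).adjugate * S 3).trace
      * (((S 3).adjugate * S x).trace * ((S 3).adjugate * S y).trace * (((S x + S y).adjugate - (S x).adjugate - (S y).adjugate) * S 3).trace) < 0 := by
    rcases Nat.mod_two_eq_zero_or_one (ρ (2 * d x + d 3) + ρ (d x + d y + d 3)) with p2 | p2 <;>
    rcases Nat.mod_two_eq_zero_or_one (ρ (2 * d 3 + d x) + ρ (2 * d 3 + d y)) with p3 | p3
    · exfalso; omega
    · nlinarith [r2.1 p2, r3.2 p3]
    · nlinarith [r2.2 p2, r3.1 p3]
    · exfalso; omega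
  -- (iii) orientation from the bottom cube
  have r0 := coeff_mul_coeff_sign_of_nullTop_eighteen d S h3 h18 m0 mxx
  rw [c0, cxx, hrank0, zero_add, ← hρ'] at r0
  rcases hor with ⟨hpsd, w⟩ | ⟨hnsd, w⟩
  · -- `S₃ ⪰ 0`: `c_{3xx} > 0`
    have hxx : 0 < ((S x).adjugate * S 3).trace := by
      rcases Nat.mod_two_eq_zero_or_one (ρ (2 * d x + d 3)) with p | p
      · have := r0.1 p
        rw [neg_one_pow_eq_pow_mod_two, p, pow_zero, one_mul] at w
        exact pos_of_mul_pos_right this w.le |> fun h => by nlinarith [this, w]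
      · have := r0.2 p
        rw [neg_one_pow_eq_pow_mod_two, p, pow_one, neg_one_mul, neg_pos] at w
        nlinarith [this, w]
    have hyy : 0 < ((S y).adjugate * S 3).trace := pos_of_mul_pos_right r1 hxx.le |> fun h => by nlinarith [r1, hxx]
    have law := semidef_pair_relation_of_nullTop_eighteen d hd S hS h3 hpsd h18 hx hxx hyy
    nlinarith [mul_pos hxx law]
  · -- `S₃ ⪯ 0`: `c_{3xx} < 0`
    have hxx : ((S x).adjugate * S 3).trace < 0 := by
      rcases Nat.mod_two_eq_zero_or_one (ρ (2 * d x + d 3)) with p | p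
      · have := r0.1 p
        rw [neg_one_pow_eq_pow_mod_two, p, pow_zero, one_mul] at w
        nlinarith [this, w]
      · have := r0.2 p
        rw [neg_one_pow_eq_pow_mod_two, p, pow_one, neg_one_mul, neg_lt_zero] at w
        nlinarith [this, w]
    have hyy : ((S y).adjugate * S 3).trace < 0 := by nlinarith [r1, hxx]
    have law := semidef_pair_relation_of_nullTop_eighteen_neg d hd S hS h3 hnsd h18 hx hxx hyy
    nlinarith [mul_pos_of_neg_of_neg hxx law]

/-! ## 5. Instances: the census bulk supports and two small interleaved supports (ranks by `decide`) -/

/-- **`(0, 4, 9, 16)`: half of the semidefinite cell is closed** — a null-top pencil with symmetric letters, `det S₃ = 0` and `S₃ ⪰ 0 ∧ det S₀ > 0`, or `S₃ ⪯ 0 ∧ det S₀ < 0`, has at most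
`17` distinct positive roots (pair test at the lower letters `0, 2`: square ranks `ρ = 6` and its partner of equal parity; `decide`). [folklore] -/
theorem card_posRoots_le_17_of_semidef_pairTest_on_0_4_9_16 (S : Fin 4 → Matrix (Fin 3) (Fin 3) ℝ) (hS : ∀ l, (S l).IsSymm)
    (h3 : (S 3).det = 0) (hor : ((S 3).PosSemidef ∧ 0 < (S 0).det) ∨ ((-(S 3)).PosSemidef ∧ (S 0).det < 0)) :
    ((Matrix.det (∑ l, ((X : ℝ[X]) ^ ((![0, 4, 9, 16] : Fin 4 → ℕ) l) • (S l).map C))).roots.toFinset.filter (fun t => 0 < t)).card ≤ 17 := by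
  have hd : StrictMono (![0, 4, 9, 16] : Fin 4 → ℕ) := by
    refine Fin.strictMono_iff_lt_succ.2 fun j => ?_
    fin_cases j <;> decide
  refine card_posRoots_le_17_of_semidef_pairTest _ hd S hS h3
    (fun e => ((({0, 4, 8, 9, 12, 13, 16, 17, 18, 20, 22, 24, 25, 27, 29, 32, 34, 36, 41} : Finset ℕ)).filter (· < e)).card) (fun e => by rw [sheetExponents_0_4_9_16])
    (x := 0) (y := 2) (by decide) (by decide) (by decide) (by decide) (by decide) ?_
  have hρ : ((({0, 4, 8, 9, 12, 13, 16, 17, 18, 20, 22, 24, 25, 27, 29, 32, 34, 36, 41} : Finset ℕ)).filter (· < 2 * (![0, 4, 9, 16] : Fin 4 → ℕ) 0 + (![0, 4, 9, 16] : Fin 4 → ℕ) 3)).card = 6 := by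
    decide
  rw [hρ]; norm_num; exact hor

/-- **`(0, 8, 17, 29)`: half of the semidefinite cell is closed** — a null-top pencil with symmetric letters, `det S₃ = 0` and `S₃ ⪰ 0 ∧ det S₀ > 0`, or `S₃ ⪯ 0 ∧ det S₀ < 0`, has at most
`17` distinct positive roots (pair test at the lower letters `0, 2`: square ranks `ρ = 6` and its partner of equal parity; `decide`). [folklore] -/
theorem card_posRoots_le_17_of_semidef_pairTest_on_0_8_17_29 (S : Fin 4 → Matrix (Fin 3) (Fin 3) ℝ) (hS : ∀ l, (S l).IsSymm)
    (h3 : (S 3).det = 0) (hor : ((S 3).PosSemidef ∧ 0 < (S 0).det) ∨ ((-(S 3)).PosSemidef ∧ (S 0).det < 0)) :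
    ((Matrix.det (∑ l, ((X : ℝ[X]) ^ ((![0, 8, 17, 29] : Fin 4 → ℕ) l) • (S l).map C))).roots.toFinset.filter (fun t => 0 < t)).card ≤ 17 := by
  have hd : StrictMono (![0, 8, 17, 29] : Fin 4 → ℕ) := by
    refine Fin.strictMono_iff_lt_succ.2 fun j => ?_
    fin_cases j <;> decide
  refine card_posRoots_le_17_of_semidef_pairTest _ hd S hS h3
    (fun e => ((({0, 8, 16, 17, 24, 25, 29, 33, 34, 37, 42, 45, 46, 51, 54, 58, 63, 66, 75} : Finset ℕ)).filter (· < e)).card) (fun e => by rw [sheetExponents_0_8_17_29])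
    (x := 0) (y := 2) (by decide) (by decide) (by decide) (by decide) (by decide) ?_
  have hρ : ((({0, 8, 16, 17, 24, 25, 29, 33, 34, 37, 42, 45, 46, 51, 54, 58, 63, 66, 75} : Finset ℕ)).filter (· < 2 * (![0, 8, 17, 29] : Fin 4 → ℕ) 0 + (![0, 8, 17, 29] : Fin 4 → ℕ) 3)).card = 6 := by
    decide
  rw [hρ]; norm_num; exact hor

/-- **`(0, 10, 22, 38)`: half of the semidefinite cell is closed** — a null-top pencil with symmetric letters, `det S₃ = 0` and `S₃ ⪰ 0 ∧ det S₀ > 0`, or `S₃ ⪯ 0 ∧ det S₀ < 0`, has at most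
`17` distinct positive roots (pair test at the lower letters `0, 2`: square ranks `ρ = 6` and its partner of equal parity; `decide`). [folklore] -/
theorem card_posRoots_le_17_of_semidef_pairTest_on_0_10_22_38 (S : Fin 4 → Matrix (Fin 3) (Fin 3) ℝ) (hS : ∀ l, (S l).IsSymm)
    (h3 : (S 3).det = 0) (hor : ((S 3).PosSemidef ∧ 0 < (S 0).det) ∨ ((-(S 3)).PosSemidef ∧ (S 0).det < 0)) :
    ((Matrix.det (∑ l, ((X : ℝ[X]) ^ ((![0, 10, 22, 38] : Fin 4 → ℕ) l) • (S l).map C))).roots.toFinset.filter (fun t => 0 < t)).card ≤ 17 := by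
  have hd : StrictMono (![0, 10, 22, 38] : Fin 4 → ℕ) := by
    refine Fin.strictMono_iff_lt_succ.2 fun j => ?_
    fin_cases j <;> decide
  refine card_posRoots_le_17_of_semidef_pairTest _ hd S hS h3
    (fun e => ((({0, 10, 20, 22, 30, 32, 38, 42, 44, 48, 54, 58, 60, 66, 70, 76, 82, 86, 98} : Finset ℕ)).filter (· < e)).card) (fun e => by rw [sheetExponents_0_10_22_38])
    (x := 0) (y := 2) (by decide) (by decide) (by decide) (by decide) (by decide) ?_
  have hρ : ((({0, 10, 20, 22, 30, 32, 38, 42, 44, 48, 54, 58, 60, 66, 70, 76, 82, 86, 98} : Finset ℕ)).filter (· < 2 * (![0, 10, 22, 38] : Fin 4 → ℕ) 0 + (![0, 10, 22, 38] : Fin 4 → ℕ) 3)).card = 6 := by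
    decide
  rw [hρ]; norm_num; exact hor

/-- The `19` sheet exponents of `(0, 8, 14, 23)`. [folklore] -/
theorem sheetExponents_0_8_14_23 :
    (((Finset.univ : Finset (Sym (Fin 4) 3)).erase (Sym.replicate 3 3)).image
        (fun s : Sym (Fin 4) 3 => ((s : Multiset (Fin 4)).map (![0, 8, 14, 23] : Fin 4 → ℕ)).sum))
      = ({0, 8, 14, 16, 22, 23, 24, 28, 30, 31, 36, 37, 39, 42, 45, 46, 51, 54, 60} : Finset ℕ) := by
  decide

/-- **`(0, 8, 14, 23)`: half of the semidefinite cell is closed** — a null-top pencil with symmetric letters, `det S₃ = 0` and `S₃ ⪰ 0 ∧ det S₀ > 0`, or `S₃ ⪯ 0 ∧ det S₀ < 0`, has at most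
`17` distinct positive roots (pair test at the lower letters `1, 2`: square ranks `ρ = 12` and its partner of equal parity; `decide`). [folklore] -/
theorem card_posRoots_le_17_of_semidef_pairTest_on_0_8_14_23 (S : Fin 4 → Matrix (Fin 3) (Fin 3) ℝ) (hS : ∀ l, (S l).IsSymm)
    (h3 : (S 3).det = 0) (hor : ((S 3).PosSemidef ∧ 0 < (S 0).det) ∨ ((-(S 3)).PosSemidef ∧ (S 0).det < 0)) :
    ((Matrix.det (∑ l, ((X : ℝ[X]) ^ ((![0, 8, 14, 23] : Fin 4 → ℕ) l) • (S l).map C))).roots.toFinset.filter (fun t => 0 < t)).card ≤ 17 := by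
  have hd : StrictMono (![0, 8, 14, 23] : Fin 4 → ℕ) := by
    refine Fin.strictMono_iff_lt_succ.2 fun j => ?_
    fin_cases j <;> decide
  refine card_posRoots_le_17_of_semidef_pairTest _ hd S hS h3
    (fun e => ((({0, 8, 14, 16, 22, 23, 24, 28, 30, 31, 36, 37, 39, 42, 45, 46, 51, 54, 60} : Finset ℕ)).filter (· < e)).card) (fun e => by rw [sheetExponents_0_8_14_23])
    (x := 1) (y := 2) (by decide) (by decide) (by decide) (by decide) (by decide) ?_
  have hρ : ((({0, 8, 14, 16, 22, 23, 24, 28, 30, 31, 36, 37, 39, 42, 45, 46, 51, 54, 60} : Finset ℕ)).filter (· < 2 * (![0, 8, 14, 23] : Fin 4 → ℕ) 1 + (![0, 8, 14, 23] : Fin 4 → ℕ) 3)).card = 12 := by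
    decide
  rw [hρ]; norm_num; exact hor

/-- The `19` sheet exponents of `(0, 3, 10, 11)`. [folklore] -/
theorem sheetExponents_0_3_10_11 :
    (((Finset.univ : Finset (Sym (Fin 4) 3)).erase (Sym.replicate 3 3)).image
        (fun s : Sym (Fin 4) 3 => ((s : Multiset (Fin 4)).map (![0, 3, 10, 11] : Fin 4 → ℕ)).sum))
      = ({0, 3, 6, 9, 10, 11, 13, 14, 16, 17, 20, 21, 22, 23, 24, 25, 30, 31, 32} : Finset ℕ) := by
  decide

/-- **`(0, 3, 10, 11)`: half of the semidefinite cell is closed** — a null-top pencil with symmetric letters, `det S₃ = 0` and `S₃ ⪰ 0 ∧ det S₀ < 0`, or `S₃ ⪯ 0 ∧ det S₀ > 0`, has at most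
`17` distinct positive roots (pair test at the lower letters `0, 1`: square ranks `ρ = 5` and its partner of equal parity; `decide`). [folklore] -/
theorem card_posRoots_le_17_of_semidef_pairTest_on_0_3_10_11 (S : Fin 4 → Matrix (Fin 3) (Fin 3) ℝ) (hS : ∀ l, (S l).IsSymm)
    (h3 : (S 3).det = 0) (hor : ((S 3).PosSemidef ∧ (S 0).det < 0) ∨ ((-(S 3)).PosSemidef ∧ 0 < (S 0).det)) :
    ((Matrix.det (∑ l, ((X : ℝ[X]) ^ ((![0, 3, 10, 11] : Fin 4 → ℕ) l) • (S l).map C))).roots.toFinset.filter (fun t => 0 < t)).card ≤ 17 := by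
  have hd : StrictMono (![0, 3, 10, 11] : Fin 4 → ℕ) := by
    refine Fin.strictMono_iff_lt_succ.2 fun j => ?_
    fin_cases j <;> decide
  refine card_posRoots_le_17_of_semidef_pairTest _ hd S hS h3
    (fun e => ((({0, 3, 6, 9, 10, 11, 13, 14, 16, 17, 20, 21, 22, 23, 24, 25, 30, 31, 32} : Finset ℕ)).filter (· < e)).card) (fun e => by rw [sheetExponents_0_3_10_11])
    (x := 0) (y := 1) (by decide) (by decide) (by decide) (by decide) (by decide) ?_
  have hρ : ((({0, 3, 6, 9, 10, 11, 13, 14, 16, 17, 20, 21, 22, 23, 24, 25, 30, 31, 32} : Finset ℕ)).filter (· < 2 * (![0, 3, 10, 11] : Fin 4 → ℕ) 0 + (![0, 3, 10, 11] : Fin 4 → ℕ) 3)).card = 5 := by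
    decide
  rw [hρ]; norm_num; exact hor

/-- The `19` sheet exponents of `(0, 1, 8, 11)`. [folklore] -/
theorem sheetExponents_0_1_8_11 :
    (((Finset.univ : Finset (Sym (Fin 4) 3)).erase (Sym.replicate 3 3)).image
        (fun s : Sym (Fin 4) 3 => ((s : Multiset (Fin 4)).map (![0, 1, 8, 11] : Fin 4 → ℕ)).sum))
      = ({0, 1, 2, 3, 8, 9, 10, 11, 12, 13, 16, 17, 19, 20, 22, 23, 24, 27, 30} : Finset ℕ) := by
  decide

/-- **`(0, 1, 8, 11)`: half of the semidefinite cell is closed** — a null-top pencil with symmetric letters, `det S₃ = 0` and `S₃ ⪰ 0 ∧ det S₀ < 0`, or `S₃ ⪯ 0 ∧ det S₀ > 0`, has at most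
`17` distinct positive roots (pair test at the lower letters `0, 2`: square ranks `ρ = 7` and its partner of equal parity; `decide`). [folklore] -/
theorem card_posRoots_le_17_of_semidef_pairTest_on_0_1_8_11 (S : Fin 4 → Matrix (Fin 3) (Fin 3) ℝ) (hS : ∀ l, (S l).IsSymm)
    (h3 : (S 3).det = 0) (hor : ((S 3).PosSemidef ∧ (S 0).det < 0) ∨ ((-(S 3)).PosSemidef ∧ 0 < (S 0).det)) :
    ((Matrix.det (∑ l, ((X : ℝ[X]) ^ ((![0, 1, 8, 11] : Fin 4 → ℕ) l) • (S l).map C))).roots.toFinset.filter (fun t => 0 < t)).card ≤ 17 := by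
  have hd : StrictMono (![0, 1, 8, 11] : Fin 4 → ℕ) := by
    refine Fin.strictMono_iff_lt_succ.2 fun j => ?_
    fin_cases j <;> decide
  refine card_posRoots_le_17_of_semidef_pairTest _ hd S hS h3
    (fun e => ((({0, 1, 2, 3, 8, 9, 10, 11, 12, 13, 16, 17, 19, 20, 22, 23, 24, 27, 30} : Finset ℕ)).filter (· < e)).card) (fun e => by rw [sheetExponents_0_1_8_11])
    (x := 0) (y := 2) (by decide) (by decide) (by decide) (by decide) (by decide) ?_
  have hρ : ((({0, 1, 2, 3, 8, 9, 10, 11, 12, 13, 16, 17, 19, 20, 22, 23, 24, 27, 30} : Finset ℕ)).filter (· < 2 * (![0, 1, 8, 11] : Fin 4 → ℕ) 0 + (![0, 1, 8, 11] : Fin 4 → ℕ) 3)).card = 7 := by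
    decide
  rw [hρ]; norm_num; exact hor

end Summit.ValiantsHypothesis.ValiantsHypothesis.Theorems.LacunarySymmetroidMatrixDescartes.Census
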